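import Literature.AlgebraicGeometry.HodgeTheory.AnalytificationImmersivePoint
import HarnessLib

/-!
# The analytification of a closed immersion of smooth varieties is an immersion — general
# analytifications (GAGA, §2 n°5–6)

Family `hodge`, layer `Literature/AlgebraicGeometry/HodgeTheory`. Theorems-only file (no definition, no
named fact). Written by the prover seat `hodge-nonav-20241-p1` (g17, cell `hodge-nonav`) as brick F-E,
part 1, of prover-Ax's programme «B4 RELATIVE RESIDUES» (route `HodgeConjecture/CyclicUnitaryPowers`).

`AnalytificationImmersivePoint` proves the statement for the HODGE MODELS of two smooth PROJECTIVE
varieties (`HodgeModel.injective_mfderiv_anMap_of_forall_exists_eval_eq`). The fibre inclusion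
`X_t ↪ 𝒳` of a smooth projective family has a quasi-projective target with no Hodge model, so this
file re-proves it, by the same argument, for ARBITRARY analytifications: `φ : M → V(ℂ)`
(`IsAnalytification E V d φ`), `ψ : M' → Y(ℂ)` (`IsAnalytification E' Y e ψ`), `V`, `Y` smooth over `ℂ`
and locally of finite type, and a map `F : M → M'` over `τ : V ⟶ Y` (`ψ ∘ F = τ(ℂ) ∘ φ`):

* `IsAnalytification.injective_mfderiv_of_forall_exists_eval_eq` — if at `P = φ b₀` every regular
  function near `P` is, at the complex points of a Zariski neighbourhood, the pull-back of a regular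
  function on `Y`, then `dF(b₀)` is injective. Proof (Serre): a holomorphic ALGEBRAIC chart `c` of
  `V(ℂ)` at `P` (`exists_algebraicChart_holds`) has regular coordinates, so `c ∘ φ` is holomorphic
  and injective near `b₀`, hence has injective differential (Clements–Osgood,
  `SCV.bijective_fderiv_of_injOn`), and factors near `b₀` as `(r ∘ ψ) ∘ F` with `r ∘ ψ` holomorphic.
* `IsAnalytification.injective_mfderiv_of_stalkMap_surjective` — the hypothesis holds where
  `𝒪_{Y,τP} → 𝒪_{V,P}` is onto (`exists_eval_eq_of_stalkMap_surjective`);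
* `IsAnalytification.injective_mfderiv_of_isClosedImmersion` — hence everywhere for a closed
  immersion `τ`: **`τ^an` is an immersion**.

The three theorems are dot-notation extensions of the structure
`Literature.NumberTheory.Transcendental.IsAnalytification` (another directory), hence declared with their
absolute names (CONVENTIONS §2).

## References

* [SerreGAGA1956] J.-P. Serre, GAGA, Ann. Inst. Fourier 6 (1956), §1 n°4, §2 n°5 (Lemme 1, Prop. 2),
  n°6 (Prop. 3, Cor. 2).
* [FritzscheGrauert2002] K. Fritzsche, H. Grauert, From Holomorphic Functions to Complex Manifolds
  (2002), Ch. I §8 Thm. 8.5 (injective holomorphic maps).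
* [Hartshorne1977] R. Hartshorne, Algebraic Geometry (1977), II §2, II Ex. 2.7.
-/

noncomputable section

open scoped Manifold ContDiff Topology
open CategoryTheory AlgebraicGeometry Set Filter
open Literature.NumberTheory.Transcendental
open Literature.AlgebraicGeometry.Motives (ComplexPoints AlgPoints)

namespace Literature.AlgebraicGeometry.HodgeTheory

section HodgeTheory

variable {d e : ℕ} {Y V : Motives.SchemeOver ℂ}
  [LocallyOfFiniteType V.hom] [SmoothOfRelativeDimension d V.hom]
  [LocallyOfFiniteType Y.hom] [SmoothOfRelativeDimension e Y.hom]
  {E : Type*} [NormedAddCommGroup E] [NormedSpace ℂ E] [FiniteDimensional ℂ E]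
  {M : Type*} [TopologicalSpace M] [ChartedSpace E M] [IsManifold 𝓘(ℂ, E) ω M]
  {E' : Type*} [NormedAddCommGroup E'] [NormedSpace ℂ E'] [FiniteDimensional ℂ E']
  {M' : Type*} [TopologicalSpace M'] [ChartedSpace E' M'] [IsManifold 𝓘(ℂ, E') ω M']
  {φ : M → ComplexPoints V} {ψ : M' → ComplexPoints Y}

/-- **`τ^an` is an immersion at a point where every germ of regular function is pulled back from the
target — arbitrary analytifications** (Serre, GAGA §2 n°5–6). Let `V`, `Y` be smooth over `ℂ`,
`φ : M → V(ℂ)` and `ψ : M' → Y(ℂ)` analytifications, `τ : V ⟶ Y`, `F : M → M'` with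
`ψ ∘ F = τ(ℂ) ∘ φ`, and `b₀ ∈ M` over `P = φ b₀` such that every regular function `s` on an affine
open `U ∋ P` agrees, at the complex points of a Zariski neighbourhood `N` of `P`, with `r ∘ τ` for a
regular function `r` on an affine open `O` of `Y`. Then `dF(b₀)` is injective. Proof: a holomorphic
algebraic chart `c` of `V(ℂ)` at `P` (`exists_algebraicChart_holds`) has regular coordinates, so
`ẽ = c ∘ φ` is holomorphic and injective near `b₀`, hence has bijective differential
(Clements–Osgood, `SCV.bijective_fderiv_of_injOn`); and near `b₀`, `ẽ_t = (r_t ∘ ψ) ∘ F` with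
`r_t ∘ ψ` holomorphic on `M'`, so `dẽ = d(r ∘ ψ) ∘ dF` and `dF(b₀)` is injective.
[cite: SerreGAGA1956, §2 n°5 Lemme 1 c), Prop. 2 and n°6 Prop. 3 Cor. 2] -/
theorem _root_.Literature.NumberTheory.Transcendental.IsAnalytification.injective_mfderiv_of_forall_exists_eval_eq
    (hφ : IsAnalytification E V d φ) (hψ : IsAnalytification E' Y e ψ) (τ : V ⟶ Y)
    (F : M → M') (hF : ψ ∘ F = AlgPoints.map τ ∘ φ) (b₀ : M)
    (hlift : ∀ (U : V.left.affineOpens) (s : Γ(V.left, ↑U)),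
      (φ b₀).pt ∈ (↑U : V.left.Opens) →
      ∃ (O : Y.left.affineOpens) (r : Γ(Y.left, ↑O)) (N : V.left.Opens),
        (φ b₀).pt ∈ N ∧
        ∀ Q : ComplexPoints V, Q.pt ∈ N →
          (AlgPoints.map τ Q).pt ∈ (↑O : Y.left.Opens) ∧
          AlgPoints.evalOrZero (↑U : V.left.Opens) s Q =
            AlgPoints.evalOrZero (↑O : Y.left.Opens) r (AlgPoints.map τ Q)) :
    Function.Injective (mfderiv 𝓘(ℂ, E) 𝓘(ℂ, E') F b₀) := by
  classical
  haveI : CompleteSpace E := FiniteDimensional.complete ℂ E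
  haveI : CompleteSpace E' := FiniteDimensional.complete ℂ E'
  -- notation
  set P : ComplexPoints V := φ b₀ with hPdef
  have hFx : ∀ x, ψ (F x) = AlgPoints.map τ (φ x) := fun x ↦ congrFun hF x
  have hFd : MDifferentiable 𝓘(ℂ, E) 𝓘(ℂ, E') F :=
    IsAnalytification.mdifferentiable_comp_map_holds hφ hψ τ F hF
  -- an algebraic chart of `V(ℂ)` at `P`
  obtain ⟨c, hPc, ⟨U, x, hsrcU, hcx⟩, -⟩ := exists_algebraicChart_holds V d P
  -- the lifts of the coordinates
  choose O r N hPN hN using fun t : Fin d ↦ hlift U (x t) (hsrcU hPc)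
  -- the charts of the models at `b₀` and `F b₀`
  set χ := extChartAt 𝓘(ℂ, E) b₀ with hχ
  set χ' := extChartAt 𝓘(ℂ, E') (F b₀) with hχ'
  set z₀ : E := χ b₀ with hz₀
  -- the chart `ẽ = c ∘ φ` read in `χ`: `G = c ∘ φ ∘ χ⁻¹`
  set G : E → (Fin d → ℂ) := fun z ↦ c (φ (χ.symm z)) with hG
  -- its domain
  set Ω : Set M := φ ⁻¹' c.source with hΩ
  have hΩo : IsOpen Ω := c.open_source.preimage hφ.isHomeomorph.continuous
  have hb₀Ω : b₀ ∈ Ω := hPc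
  set W : Set E := χ.target ∩ χ.symm ⁻¹' (Ω ∩ χ.source) with hW
  have hWo : IsOpen W := by
    refine (continuousOn_extChartAt_symm b₀).isOpen_inter_preimage (isOpen_extChartAt_target b₀) ?_
    exact hΩo.inter (isOpen_extChartAt_source b₀)
  have hz₀W : z₀ ∈ W := by
    refine ⟨mem_extChartAt_target b₀, ?_⟩
    change χ.symm (χ b₀) ∈ Ω ∩ χ.source
    rw [extChartAt_to_inv]
    exact ⟨hb₀Ω, mem_extChartAt_source b₀⟩
  -- `G` is holomorphic on `W`
  have hGd : DifferentiableOn ℂ G W := by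
    refine differentiableOn_pi.2 fun t ↦ ?_
    have h1 : MDifferentiableOn 𝓘(ℂ, E) 𝓘(ℂ, ℂ)
        (fun b ↦ AlgPoints.evalOrZero (↑U : V.left.Opens) (x t) (φ b))
        (φ ⁻¹' {Q | Q.pt ∈ (↑U : V.left.Opens)}) :=
      hφ.mdifferentiableOn_evalOrZero U (x t)
    have h2 : MDifferentiableOn 𝓘(ℂ, E) 𝓘(ℂ, ℂ)
        ((fun b ↦ AlgPoints.evalOrZero (↑U : V.left.Opens) (x t) (φ b)) ∘ χ.symm) W := by
      refine h1.comp ((mdifferentiableOn_extChartAt_symm (I := 𝓘(ℂ, E)) (x := b₀)).mono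
        Set.inter_subset_left) ?_
      rintro z ⟨-, hzΩ, -⟩
      exact hsrcU hzΩ
    have h3 : DifferentiableOn ℂ
        ((fun b ↦ AlgPoints.evalOrZero (↑U : V.left.Opens) (x t) (φ b)) ∘ χ.symm) W :=
      mdifferentiableOn_iff_differentiableOn.1 h2
    refine h3.congr fun z hz ↦ ?_
    obtain ⟨-, hzΩ, -⟩ := hz
    exact hcx _ hzΩ t
  -- `G` is injective on `W`
  have hGinj : InjOn G W := by
    rintro z ⟨hzt, hzΩ, -⟩ z' ⟨hz't, hz'Ω, -⟩ h
    have h1 : φ (χ.symm z) = φ (χ.symm z') := c.injOn hzΩ hz'Ω h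
    have h2 : χ.symm z = χ.symm z' := hφ.isHomeomorph.injective h1
    exact χ.symm.injOn hzt hz't h2
  -- Clements–Osgood: `dG(z₀)` is injective
  have hdim : Module.finrank ℂ E = Module.finrank ℂ (Fin d → ℂ) := by
    rw [hφ.finrank_eq, Module.finrank_fin_fun]
  have hGi : Function.Injective (fderiv ℂ G z₀) :=
    (Literature.Analysis.Complex.SCV.bijective_fderiv_of_injOn hdim hGd hWo hGinj hz₀W).1
  -- the factorisation `G = R ∘ (χ' ∘ F ∘ χ⁻¹)` near `z₀`
  set R : E' → (Fin d → ℂ) := fun w t ↦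
    AlgPoints.evalOrZero (↑(O t) : Y.left.Opens) (r t) (ψ (χ'.symm w)) with hR
  set Fc : E → E' := fun z ↦ χ' (F (χ.symm z)) with hFc
  -- `F b₀` lies over `τ P`
  have hFP : ψ (F b₀) = AlgPoints.map τ P := hFx b₀
  -- `R` is differentiable at `w₀ = χ' (F b₀)`
  have hRd : DifferentiableAt ℂ R (χ' (F b₀)) := by
    refine differentiableAt_pi.2 fun t ↦ ?_
    have h1 : MDifferentiableOn 𝓘(ℂ, E') 𝓘(ℂ, ℂ)
        (fun a ↦ AlgPoints.evalOrZero (↑(O t) : Y.left.Opens) (r t) (ψ a))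
        (ψ ⁻¹' {Q | Q.pt ∈ (↑(O t) : Y.left.Opens)}) :=
      hψ.mdifferentiableOn_evalOrZero (O t) (r t)
    have hmem : F b₀ ∈ ψ ⁻¹' {Q | Q.pt ∈ (↑(O t) : Y.left.Opens)} := by
      change (ψ (F b₀)).pt ∈ (↑(O t) : Y.left.Opens)
      rw [hFP]
      exact (hN t P (hPN t)).1
    have hopen : IsOpen (ψ ⁻¹' {Q : ComplexPoints Y | Q.pt ∈ (↑(O t) : Y.left.Opens)}) :=
      hψ.isOpen_preimage _
    have h2 : MDifferentiableAt 𝓘(ℂ, E') 𝓘(ℂ, ℂ)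
        (fun a ↦ AlgPoints.evalOrZero (↑(O t) : Y.left.Opens) (r t) (ψ a)) (F b₀) :=
      h1.mdifferentiableAt (hopen.mem_nhds hmem)
    have h3 := h2.differentiableWithinAt_writtenInExtChartAt
    rw [ModelWithCorners.Boundaryless.range_eq_univ, differentiableWithinAt_univ] at h3
    exact h3
  -- `Fc` is differentiable at `z₀`
  have hFcd : DifferentiableAt ℂ Fc z₀ := by
    have h3 := (hFd b₀).differentiableWithinAt_writtenInExtChartAt
    rw [ModelWithCorners.Boundaryless.range_eq_univ, differentiableWithinAt_univ] at h3
    exact h3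
  -- the factorisation holds near `z₀`
  have hNopen : IsOpen {Q : ComplexPoints V | ∀ t, Q.pt ∈ N t} := by
    rw [Set.setOf_forall]
    exact isOpen_iInter_of_finite fun t ↦ AlgPoints.isOpen_setOf_pt_mem _
  set T : Set M := (Ω ∩ χ.source) ∩ (φ ⁻¹' {Q | ∀ t, Q.pt ∈ N t} ∩ F ⁻¹' χ'.source) with hT
  have hTo : IsOpen T :=
    (hΩo.inter (isOpen_extChartAt_source b₀)).inter
      ((hNopen.preimage hφ.isHomeomorph.continuous).inter
        ((isOpen_extChartAt_source (F b₀)).preimage hFd.continuous))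
  have hb₀T : b₀ ∈ T :=
    ⟨⟨hb₀Ω, mem_extChartAt_source b₀⟩, fun t ↦ hPN t, mem_extChartAt_source (F b₀)⟩
  set S : Set E := χ.target ∩ χ.symm ⁻¹' T with hS
  have hSo : IsOpen S :=
    (continuousOn_extChartAt_symm b₀).isOpen_inter_preimage (isOpen_extChartAt_target b₀) hTo
  have hz₀S : z₀ ∈ S := by
    refine ⟨mem_extChartAt_target b₀, ?_⟩
    change χ.symm (χ b₀) ∈ T
    rw [extChartAt_to_inv]
    exact hb₀T
  have hGRF : G =ᶠ[𝓝 z₀] R ∘ Fc := by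
    refine Filter.eventuallyEq_of_mem (hSo.mem_nhds hz₀S) ?_
    rintro z ⟨-, ⟨hzΩ, -⟩, hzN, hzA⟩
    funext t
    change c (φ (χ.symm z)) t =
      AlgPoints.evalOrZero (↑(O t) : Y.left.Opens) (r t) (ψ (χ'.symm (χ' (F (χ.symm z)))))
    rw [hcx _ hzΩ t, χ'.left_inv hzA, hFx (χ.symm z)]
    exact (hN t _ (hzN t)).2
  -- chain rule
  have hFcz₀ : Fc z₀ = χ' (F b₀) := by
    change χ' (F (χ.symm (χ b₀))) = _
    rw [extChartAt_to_inv]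
  have hcomp : fderiv ℂ G z₀ = (fderiv ℂ R (Fc z₀)).comp (fderiv ℂ Fc z₀) := by
    rw [hGRF.fderiv_eq]
    refine fderiv_comp z₀ ?_ hFcd
    rw [hFcz₀]
    exact hRd
  have hFci : Function.Injective (fderiv ℂ Fc z₀) := by
    intro u v huv
    apply hGi
    rw [hcomp, ContinuousLinearMap.comp_apply, ContinuousLinearMap.comp_apply, huv]
  -- `mfderiv F b₀ = fderiv Fc z₀`
  have hmf : mfderiv 𝓘(ℂ, E) 𝓘(ℂ, E') F b₀ = fderiv ℂ Fc z₀ := by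
    rw [(hFd b₀).mfderiv, ModelWithCorners.Boundaryless.range_eq_univ, fderivWithin_univ]
    rfl
  rw [hmf]
  exact hFci

/-- **`τ^an` is an immersion at every point where `τ` is surjective on the stalk** (e.g. `τ` a closed
immersion near `φ b₀`), for arbitrary analytifications of the smooth `V`, `Y`
(`exists_eval_eq_of_stalkMap_surjective` supplies the lifts of germs).
[cite: SerreGAGA1956, §2 n°6 Prop. 3 Cor. 2] [cite: Hartshorne1977, II §2 and II Ex. 2.7] -/
theorem _root_.Literature.NumberTheory.Transcendental.IsAnalytification.injective_mfderiv_of_stalkMap_surjective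
    (hφ : IsAnalytification E V d φ) (hψ : IsAnalytification E' Y e ψ) (τ : V ⟶ Y)
    (F : M → M') (hF : ψ ∘ F = AlgPoints.map τ ∘ φ) (b₀ : M)
    (hτ : Function.Surjective (τ.left.stalkMap (φ b₀).pt)) :
    Function.Injective (mfderiv 𝓘(ℂ, E) 𝓘(ℂ, E') F b₀) :=
  hφ.injective_mfderiv_of_forall_exists_eval_eq hψ τ F hF b₀ fun U s hPU ↦
    exists_eval_eq_of_stalkMap_surjective τ (φ b₀) hτ U s hPU

/-- **The analytification of a closed immersion of smooth complex varieties is an immersion**: for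
`τ : V ⟶ Y` a closed immersion (`V`, `Y` smooth over `ℂ`, locally of finite type), analytifications
`φ`, `ψ`, and `F : M → M'` over `τ`, the complex differential `dF(b)` is injective at every `b ∈ M`
(a closed immersion is surjective on all stalks). [cite: SerreGAGA1956, §2 n°6 Prop. 3 Cor. 2]
[cite: Hartshorne1977, II Ex. 3.11] -/
theorem _root_.Literature.NumberTheory.Transcendental.IsAnalytification.injective_mfderiv_of_isClosedImmersion
    (hφ : IsAnalytification E V d φ) (hψ : IsAnalytification E' Y e ψ) (τ : V ⟶ Y)
    [IsClosedImmersion τ.left] (F : M → M') (hF : ψ ∘ F = AlgPoints.map τ ∘ φ) (b : M) :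
    Function.Injective (mfderiv 𝓘(ℂ, E) 𝓘(ℂ, E') F b) :=
  hφ.injective_mfderiv_of_stalkMap_surjective hψ τ F hF b (τ.left.stalkMap_surjective (φ b).pt)

end HodgeTheory

end Literature.AlgebraicGeometry.HodgeTheory

end
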